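import Literature.Topology.FourManifolds.HomotopySpheresSignatureLemma71
import Literature.Topology.FourManifolds.SphereSurgeryMiddleHomology
import HarnessLib

/-!
# Kervaire–Milnor's Thm. 7.5 reduced to the embedding half of Lemma 7.1: the surgery is proved

Topic `Literature/Topology/FourManifolds`; fifth pure-proof sibling (after
`HomotopySpheresSignatureProofs.lean`, `…Reduction.lean`, `…Killing.lean`, `…Lemma71.lean`) of
the named fact `Literature.Topology.FourManifolds.HomotopySphere.mk_eq_mk_iff_sigmaGen_dvd_sub`:
M. Kervaire, J. Milnor, *Groups of homotopy spheres I*, Ann. of Math. 77 (1963), **Thm. 7.5**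
(pp. 529–530). Everything here is **proved**; no definition, no named fact and no statement is
added or changed (D-0026, net debt `0`).

`HomotopySpheresSignatureLemma71.lean` left Thm. 7.5 as the consequence
(`mk_eq_mk_iff_sigmaGen_dvd_sub_of_lemma71`) of (`h71`) Kervaire–Milnor's **Lemma 7.1** with
[17, Lemma 7] and the last clause of Thm. 6.6 — for an s-parallelizable `(2m-1)`-connected
null-cobordism whose closed-model intersection form has a basis `{λᵢ, μⱼ}`, `λᵢ·λⱼ = 0`,
`λᵢ·μⱼ = δᵢⱼ`, the same homotopy sphere bounds a `2m`-connected manifold — together with Kosinski's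
X.2.2 and Smale's h-cobordism theorem. Lemma 7.1's printed proof (p. 527) has an EMBEDDING half
("any homology class in `HₖM` can be represented by a differentiably imbedded sphere" [17,
Lemma 6] / Haefliger; "since the normal bundle is trivial, `φ₀` can be extended to an imbedding
`φ : Sᵏ × Dᵏ → M`") and a SURGERY half ("let `M' = χ(M, φ)` … Since `μᵣ·λᵣ = 1` it follows that
`Hₖ₋₁M₀ = 0` … `M₀` and `M'` are `(k-1)`-connected … `HₖM'` is isomorphic to a quotient group
of `HₖM₀` … Iterating this construction `r` times, the result will be a `k`-connected
manifold"). The surgery half is now a theorem of the tree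
(`SphereSurgeryMiddleHomology.lean`: `FramedSphereFamily.isZero_singularHomology_surgered_middle`,
`…_surgered_of_le`, `simplyConnectedSpace_surgered_family`, for the simultaneous surgery along
the `r` disjoint spheres, Milnor 1965 §3 p. 21), with its two hypotheses stated homologically on
the family of embedded spheres `Sᵢ`: primitivity `H₂ₘ(M) ↠ H₂ₘ(M | ⋃ Sᵢ)` ("`λᵢ·μⱼ = δᵢⱼ`")
and isotropy `ker ⊆ span {[Sᵢ]}` ("`λᵢ·λⱼ = 0`" for a basis). This file therefore **discharges
the surgery half** and restates Thm. 7.5 over the embedding half only: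

* `HomotopySphere.lemma71_of_sphereFamily` — `h71` (Lemma 7.1 + Thm. 6.6 in the binder shape of
  `…_of_lemma71`) PROVED from (`hrep`) the embedding half: the null-cobordism `χ(M, ν)`
  (`NullCobordism.surgery`, `bχ = bM`) is simply connected with `Hᵢ = 0` for `0 < i ≤ 2m`
  (an empty family needs no surgery: then `H₂ₘ(M) = 0` already).
* `HomotopySphere.mk_eq_mk_iff_sigmaGen_dvd_sub_of_sphereFamily` — **Thm. 7.5 from `hrep`, `hconn`
  (X.2.2) and `hcob` (Smale)**.
* `HomotopySphereClass.isCyclic_bP_four_mul_of_sphereFamily` — Cor. 7.6 over the same frontier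
  plus Lemma 7.4 (`m > 1`), for the parked seat of `isCyclic_bP_four_mul`.
* `exists_commGroup_homotopySphereClass_isCyclic_seven_of_sphereFamily` — the cone target `Θ₇`
  cyclic over the same frontier at `n = 7` (plus Lemma 3.4 "⇒" and `Θ₇ = bP₈`).

So the printed results separating the tree from `mk_eq_mk_iff_sigmaGen_dvd_sub_holds` are now
exactly: the embedding half of Lemma 7.1 (disjoint framed embedded `2m`-spheres realising a
Kervaire–Milnor basis — Whitney–Haefliger embedding, [17, Lemma 7], and the identification of the
intersection numbers `·λᵢ` with the local classes at `Sᵢ`, Milnor 1965 Lemma 6.3), Kosinski X.2.2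
(surgery below the middle dimension) and the h-cobordism theorem.

## References

* M. Kervaire, J. Milnor, *Groups of homotopy spheres I*, Ann. of Math. 77 (1963), 504–537:
  Lemma 7.1 and its proof (pp. 526–528), Lemma 7.3 (p. 529), Thm. 6.6 (p. 526), Thm. 7.5
  (pp. 529–530), Cor. 7.6 (p. 530). doi:10.2307/1970128 [KervaireMilnorAnnals1963]
* J. Milnor, *A procedure for killing the homotopy groups of differentiable manifolds*, Proc.
  Sympos. Pure Math. III, AMS (1961), 39–55, Lemmas 6, 7. [MilnorKilling1961]
* A. Kosinski, *Differential Manifolds* (1993), Ch. X, Thm. (2.2), (3.1), Thm. (3.4), Cor. (3.6).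
  [Kosinski1993]
* J. Milnor, *Lectures on the h-cobordism theorem* (1965), Def. 3.11, §3 p. 21, Lemma 6.3,
  Thm. 9.1. [MilnorHCobordism1965]
-/

open scoped Manifold ContDiff Topology
open Set Function CategoryTheory Limits
open Literature.AlgebraicTopology.SingularHomology

noncomputable section

namespace Literature.Topology.FourManifolds

namespace HomotopySphere

variable {n : ℕ}

/-! ### Lemma 7.1, second half (the surgery), proved: `h71` from the embedded family -/

/-- **Kervaire–Milnor 1963, Lemma 7.1 with Thm. 6.6 — the surgical half PROVED.** For
`n + 1 = 4m`, `m > 1`: GIVEN (`hrep`) **the embedding half of Lemma 7.1** — for a homotopy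
`n`-sphere `Σ = bM`, `M = c.W` compact, simply connected, `Hᵢ(M; ℤ) = 0` for `0 < i < 2m`,
s-parallelizable, oriented with `(Σ, μ) = bM`, whose intersection form on `H²ᵐ(M̂; ℤ)/T` has a
Kervaire–Milnor basis `{λᵢ, μⱼ}` (`λᵢ·λⱼ = 0`, `λᵢ·μⱼ = δᵢⱼ`), there is a finite framed family
`ν` of disjoint embedded `2m`-spheres `Sᵢ ⊆ M` with trivial normal bundle such that
(primitivity, "`λᵢ · μⱼ = δᵢⱼ`") `H₂ₘ(M) → H₂ₘ(M | ⋃ Sᵢ)` is onto and (isotropy, "`λᵢ · λⱼ = 0`",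
with `{λᵢ, μⱼ}` a basis) the classes of `H₂ₘ(M)` restricting to zero at the spheres are
combinations of the sphere classes `(Sᵢ)_*H₂ₘ(S²ᵐ)` (Kervaire–Milnor p. 527, lines 1–9:
"any homology class in `HₖM` can be represented by a differentiably imbedded sphere"
[17, Lemma 6] / Haefliger, "since the normal bundle is trivial, `φ₀` can be extended to an
imbedding `φ : Sᵏ × Dᵏ → M`" [17, Lemma 7]; with the spheres made disjoint and the
intersection numbers read as local classes at the spheres, Milnor 1965 Lemma 6.3) — the
conclusion of Lemma 7.1 with Thm. 6.6 in the form `h71` of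
`mk_eq_mk_iff_sigmaGen_dvd_sub_of_lemma71`: **`Σ` bounds a simply connected `M₁` with
`Hᵢ(M₁; ℤ) = 0` for `0 < i ≤ 2m`**, namely `M₁ = χ(M, ν)`, the simultaneous surgery along the
family (Milnor 1965, Def. 3.11, §3 p. 21; Kervaire–Milnor iterate one sphere at a time, p. 528
"Iterating this construction `r` times"). The homology of `χ(M, ν)` is the tree theorem
`FramedSphereFamily.isZero_singularHomology_surgered_middle` /`…_of_le` (Kervaire–Milnor
p. 527: "`H_{k-1}M₀ = 0` … `M₀` and `M'` are `(k-1)`-connected … `HₖM'` is isomorphic to a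
quotient group of `HₖM₀`"), its fundamental group `simplyConnectedSpace_surgered_family`, and
`bχ = bM` is `NullCobordism.surgery`.
[cite: KervaireMilnorAnnals1963, Lemma 7.1 (pp. 526–528) with Thm. 6.6 (p. 526)] [cite: MilnorHCobordism1965, Def. 3.11 (PDF p. 17), §3 (PDF p. 21)] -/
theorem lemma71_of_sphereFamily {m : ℕ} (h : n + 1 = 4 * m) (hm : 1 < m)
    (hrep : ∀ (S : HomotopySphere n) (c : NullCobordism n S.carrier)
      (μ : HomologicalOrientation ℤ S.carrier n)
      (μ' : HomologicalOrientation ℤ (ClosedModel n c.W) (n + 1)),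
      SimplyConnectedSpace c.W →
      (∀ i : ℕ, 0 < i → i < 2 * m → Subsingleton (singularHomology ℤ ℤ c.W i)) →
      IsStablyParallelizable (𝓡∂ (n + 1)) c.W → c.IsOrientedBy μ μ' →
      (∃ (r : ℕ) (b : Module.Basis (Fin r ⊕ Fin r) ℤ
          (freeCohomology ℤ (ClosedModel n c.W) (2 * m))),
        Module.finrank ℤ (freeCohomology ℤ (ClosedModel n c.W) (2 * m)) = 2 * r ∧
        (∀ i j, intersectionForm (show 2 * m + 2 * m = n + 1 by omega) μ'
          (b (Sum.inl i)) (b (Sum.inl j)) = 0) ∧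
        ∀ i j, intersectionForm (show 2 * m + 2 * m = n + 1 by omega) μ'
          (b (Sum.inl i)) (b (Sum.inr j)) = if i = j then 1 else 0) →
        ∃ (ι : Type) (_ : Fintype ι) (ν : FramedSphereFamily (𝓡∂ (n + 1)) c.W ι (2 * m) (2 * m)),
          Function.Surjective (singularHomology.toLocalOfSet ℤ ℤ c.W ν.cores (2 * m)) ∧
          ∀ x : singularHomology ℤ ℤ c.W (2 * m),
            singularHomology.toLocalOfSet ℤ ℤ c.W ν.cores (2 * m) x = 0 →
              x ∈ Submodule.span ℤ (⋃ i, Set.range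
                (singularHomology.map ℤ ℤ ⟨ν.sphere i, ν.continuous_sphere i⟩ (2 * m))))
    (S : HomotopySphere n) (c : NullCobordism n S.carrier)
    (μ : HomologicalOrientation ℤ S.carrier n)
    (μ' : HomologicalOrientation ℤ (ClosedModel n c.W) (n + 1))
    (hsc : SimplyConnectedSpace c.W)
    (hH : ∀ i : ℕ, 0 < i → i < 2 * m → Subsingleton (singularHomology ℤ ℤ c.W i))
    (hspar : IsStablyParallelizable (𝓡∂ (n + 1)) c.W) (hob : c.IsOrientedBy μ μ')
    (hbasis : ∃ (r : ℕ) (b : Module.Basis (Fin r ⊕ Fin r) ℤ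
        (freeCohomology ℤ (ClosedModel n c.W) (2 * m))),
      Module.finrank ℤ (freeCohomology ℤ (ClosedModel n c.W) (2 * m)) = 2 * r ∧
      (∀ i j, intersectionForm (show 2 * m + 2 * m = n + 1 by omega) μ'
        (b (Sum.inl i)) (b (Sum.inl j)) = 0) ∧
      ∀ i j, intersectionForm (show 2 * m + 2 * m = n + 1 by omega) μ'
        (b (Sum.inl i)) (b (Sum.inr j)) = if i = j then 1 else 0) :
    ∃ c₁ : NullCobordism n S.carrier, SimplyConnectedSpace c₁.W ∧
      ∀ i : ℕ, 0 < i → i ≤ 2 * m → Subsingleton (singularHomology ℤ ℤ c₁.W i) := by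
  haveI := hsc
  obtain ⟨ι, _, ν, hsurj, hker⟩ := hrep S c μ μ' hsc hH hspar hob hbasis
  rcases isEmpty_or_nonempty ι with hι | hι
  · -- no spheres: `H₂ₘ(M)` restricts into `H₂ₘ(M | ∅) = 0`, so it is spanned by nothing
    refine ⟨c, hsc, fun i hi him ↦ ?_⟩
    rcases him.lt_or_eq with hlt | rfl
    · exact hH i hi hlt
    · have hcores : ν.cores = ∅ := by
        rw [FramedSphereFamily.cores, Set.iUnion_eq_empty]
        exact fun i ↦ (IsEmpty.false i).elim
      have h0 : IsZero (localHomologyOfSet ℤ ℤ c.W ν.cores (2 * m)) := by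
        rw [hcores]
        exact isZero_localHomologyOfSet_empty ℤ ℤ (2 * m)
      refine subsingleton_of_forall_eq 0 fun x ↦ ?_
      have hx := hker x (by
        haveI := ModuleCat.subsingleton_of_isZero h0
        exact Subsingleton.elim _ _)
      rwa [Set.iUnion_of_empty, Submodule.span_empty, Submodule.mem_bot] at hx
  · -- surgery along the family
    generalize hK : 2 * m = K at ν hsurj hker ⊢
    obtain ⟨l, rfl⟩ : ∃ l, K = l + 1 := ⟨K - 1, by omega⟩
    have hkl : l + 1 + l = n := by omega
    haveI : Nonempty S.carrier := S.nonempty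
    refine ⟨c.surgery ν hkl, ?_, fun i hi him ↦ ?_⟩
    · exact FramedSphereFamily.simplyConnectedSpace_surgered_family ν hkl (by omega) (by omega)
    · apply ModuleCat.subsingleton_of_isZero
      show IsZero (singularHomology ℤ ℤ (ν.Surgered hkl) i)
      rcases him.lt_or_eq with hlt | rfl
      · haveI := hH i hi (by omega)
        exact FramedSphereFamily.isZero_singularHomology_surgered_of_le ℤ ℤ ν hkl (by omega)
          (ModuleCat.isZero_of_subsingleton _) hsurj
      · exact FramedSphereFamily.isZero_singularHomology_surgered_middle ℤ ℤ ν hkl hker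

/-! ### Thm. 7.5 over the embedding half of Lemma 7.1, X.2.2 and the h-cobordism theorem -/

/-- **Kervaire–Milnor Thm. 7.5 from the embedding half of Lemma 7.1, Kosinski's X.2.2 and Smale's
h-cobordism theorem; the surgery of Lemma 7.1, the algebra of Lemma 7.3, the last clause of
Thm. 6.6 and §2-additivity discharged.** The named fact `mk_eq_mk_iff_sigmaGen_dvd_sub`
(Thm. 7.5, pp. 529–530) GIVEN: (`hrep`) for all `n + 1 = 4m`, `m > 1`, **the embedding half of
Lemma 7.1** (p. 527, lines 1–9, with [17, Lemmas 6, 7] / Haefliger): a `(2m-1)`-connected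
s-parallelizable null-cobordism `M = c.W` of a homotopy `n`-sphere, oriented with `(Σ, μ) = bM`,
whose closed-model intersection form has a Kervaire–Milnor basis `{λᵢ, μⱼ}`, contains a finite
framed family of disjoint embedded `2m`-spheres `Sᵢ` with `H₂ₘ(M) → H₂ₘ(M | ⋃ Sᵢ)` onto
(`λᵢ·μⱼ = δᵢⱼ`) and `ker ⊆ span {(Sᵢ)_*H₂ₘ(S²ᵐ)}` (`λᵢ·λⱼ = 0`, `{λᵢ, μⱼ}` a basis) — the one
printed input not in the tree (differential topology: Whitney–Haefliger embedding of the `λᵢ` by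
disjoint spheres, triviality of their normal bundles from `λᵢ·λᵢ = 0`, and the reading of the
intersection numbers `·λᵢ` as the local classes at `Sᵢ`, Milnor 1965 Lemma 6.3); (`hconn`) the
named fact `exists_highlyConnected_of_mem_signatureSet` (Kosinski X.2.2, X.3.3; Kervaire–Milnor
Thm. 5.5); (`hcob`) the named fact `nonempty_diffeomorph_of_isHCobordant_of_five_le` (Smale).
PROVED inputs: the surgical half of Lemma 7.1 with Thm. 6.6 (`lemma71_of_sphereFamily`, from
`FramedSphereFamily.isZero_singularHomology_surgered_middle` / `…_of_le` /
`simplyConnectedSpace_surgered_family` and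
`NullCobordism.contractibleSpace_of_isZero_singularHomology_le`), unimodularity and the basis
(`exists_basis_isotropic_dual_intersectionForm_closedModel`), Lemma 2.3, Thm. 1.1's group laws,
§2-additivity. Assembly: `mk_eq_mk_iff_sigmaGen_dvd_sub_of_lemma71`.
[cite: KervaireMilnorAnnals1963, Thm. 7.5 (pp. 529–530), with Lemma 7.1 (pp. 526–528), Lemma 7.3 (pp. 528–529), Thm. 5.5 (p. 514), Thm. 6.6 (p. 526)] [cite: Kosinski1993, Ch. X, Thm. (2.2), Thm. (3.4), Cor. (3.6)] [cite: MilnorHCobordism1965, Thm. 9.1, Def. 3.11] -/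
theorem mk_eq_mk_iff_sigmaGen_dvd_sub_of_sphereFamily
    (hrep : ∀ (n m : ℕ) (h : n + 1 = 4 * m), 1 < m →
      ∀ (S : HomotopySphere n) (c : NullCobordism n S.carrier)
        (μ : HomologicalOrientation ℤ S.carrier n)
        (μ' : HomologicalOrientation ℤ (ClosedModel n c.W) (n + 1)),
        SimplyConnectedSpace c.W →
        (∀ i : ℕ, 0 < i → i < 2 * m → Subsingleton (singularHomology ℤ ℤ c.W i)) →
        IsStablyParallelizable (𝓡∂ (n + 1)) c.W → c.IsOrientedBy μ μ' →
        (∃ (r : ℕ) (b : Module.Basis (Fin r ⊕ Fin r) ℤ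
            (freeCohomology ℤ (ClosedModel n c.W) (2 * m))),
          Module.finrank ℤ (freeCohomology ℤ (ClosedModel n c.W) (2 * m)) = 2 * r ∧
          (∀ i j, intersectionForm (show 2 * m + 2 * m = n + 1 by omega) μ'
            (b (Sum.inl i)) (b (Sum.inl j)) = 0) ∧
          ∀ i j, intersectionForm (show 2 * m + 2 * m = n + 1 by omega) μ'
            (b (Sum.inl i)) (b (Sum.inr j)) = if i = j then 1 else 0) →
          ∃ (ι : Type) (_ : Fintype ι) (ν : FramedSphereFamily (𝓡∂ (n + 1)) c.W ι (2 * m) (2 * m)),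
            Function.Surjective (singularHomology.toLocalOfSet ℤ ℤ c.W ν.cores (2 * m)) ∧
            ∀ x : singularHomology ℤ ℤ c.W (2 * m),
              singularHomology.toLocalOfSet ℤ ℤ c.W ν.cores (2 * m) x = 0 →
                x ∈ Submodule.span ℤ (⋃ i, Set.range
                  (singularHomology.map ℤ ℤ ⟨ν.sphere i, ν.continuous_sphere i⟩ (2 * m))))
    (hconn : exists_highlyConnected_of_mem_signatureSet)
    (hcob : FourManifolds.nonempty_diffeomorph_of_isHCobordant_of_five_le.{0}) :
    mk_eq_mk_iff_sigmaGen_dvd_sub :=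
  mk_eq_mk_iff_sigmaGen_dvd_sub_of_lemma71
    (fun n m h hm ↦ lemma71_of_sphereFamily h hm (hrep n m h hm)) hconn hcob

end HomotopySphere

/-! ### Cor. 7.6 and the cone target `Θ₇` over the same frontier -/

namespace HomotopySphereClass

open HomotopySphere

/-- **Kervaire–Milnor Cor. 7.6 (`bP₄ₘ` finite cyclic, `m > 1`) from Lemma 7.4 (`m > 1`), the
embedding half of Lemma 7.1, Kosinski's X.2.2 and the h-cobordism theorem** — the named fact
`isCyclic_bP_four_mul` over the frontier of
`HomotopySphere.mk_eq_mk_iff_sigmaGen_dvd_sub_of_sphereFamily`: (`h74`) Lemma 7.4 in the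
dimensions `4m - 1`, `m > 1`; (`hrep`) the embedding half of Lemma 7.1 (disjoint framed embedded
`2m`-spheres realising a Kervaire–Milnor basis, primitive and isotropic); (`hconn`) X.2.2;
(`hcob`) Smale. The surgery of Lemma 7.1 is proved (`lemma71_of_sphereFamily`). Assembly:
`isCyclic_bP_four_mul_of_lemma71`.
[cite: KervaireMilnorAnnals1963, Cor. 7.6 (p. 530), with Thm. 7.5, Lemma 7.1 (pp. 526–528), Lemma 7.3 (p. 529), Lemma 7.4 (p. 529), Thm. 6.6 (p. 526)] [cite: Kosinski1993, Ch. X, Thm. (2.2) and Thm. (3.4)] [cite: MilnorHCobordism1965, Thm. 9.1] -/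
theorem isCyclic_bP_four_mul_of_sphereFamily
    (h74 : ∀ (n m : ℕ) (h : n + 1 = 4 * m), 1 < m →
      ∀ g : HomologicalOrientation ℤ (EuclideanSpace ℝ (Fin n)) n,
        ∃ (o : SmoothOrientation (𝓡 n) (Metric.sphere (0 : EuclideanSpace ℝ (Fin (n + 1))) 1))
          (σ : ℤ),
        σ ∈ signatureSet g m h ⟨Metric.sphere (0 : EuclideanSpace ℝ (Fin (n + 1))) 1, o, ⟨.refl _⟩⟩
          ∧ σ ≠ 0)
    (hrep : ∀ (n m : ℕ) (h : n + 1 = 4 * m), 1 < m →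
      ∀ (S : HomotopySphere n) (c : NullCobordism n S.carrier)
        (μ : HomologicalOrientation ℤ S.carrier n)
        (μ' : HomologicalOrientation ℤ (ClosedModel n c.W) (n + 1)),
        SimplyConnectedSpace c.W →
        (∀ i : ℕ, 0 < i → i < 2 * m → Subsingleton (singularHomology ℤ ℤ c.W i)) →
        IsStablyParallelizable (𝓡∂ (n + 1)) c.W → c.IsOrientedBy μ μ' →
        (∃ (r : ℕ) (b : Module.Basis (Fin r ⊕ Fin r) ℤ
            (freeCohomology ℤ (ClosedModel n c.W) (2 * m))),
          Module.finrank ℤ (freeCohomology ℤ (ClosedModel n c.W) (2 * m)) = 2 * r ∧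
          (∀ i j, intersectionForm (show 2 * m + 2 * m = n + 1 by omega) μ'
            (b (Sum.inl i)) (b (Sum.inl j)) = 0) ∧
          ∀ i j, intersectionForm (show 2 * m + 2 * m = n + 1 by omega) μ'
            (b (Sum.inl i)) (b (Sum.inr j)) = if i = j then 1 else 0) →
          ∃ (ι : Type) (_ : Fintype ι) (ν : FramedSphereFamily (𝓡∂ (n + 1)) c.W ι (2 * m) (2 * m)),
            Function.Surjective (singularHomology.toLocalOfSet ℤ ℤ c.W ν.cores (2 * m)) ∧
            ∀ x : singularHomology ℤ ℤ c.W (2 * m),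
              singularHomology.toLocalOfSet ℤ ℤ c.W ν.cores (2 * m) x = 0 →
                x ∈ Submodule.span ℤ (⋃ i, Set.range
                  (singularHomology.map ℤ ℤ ⟨ν.sphere i, ν.continuous_sphere i⟩ (2 * m))))
    (hconn : exists_highlyConnected_of_mem_signatureSet)
    (hcob : FourManifolds.nonempty_diffeomorph_of_isHCobordant_of_five_le.{0}) :
    isCyclic_bP_four_mul :=
  isCyclic_bP_four_mul_of_lemma71 h74
    (fun n m h hm ↦ lemma71_of_sphereFamily h hm (hrep n m h hm)) hconn hcob

end HomotopySphereClass

/-- **`Θ₇` is a cyclic group under connected sum, from the embedding half of Lemma 7.1 at `n = 7`,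
Kosinski's X.2.2, Smale's h-cobordism theorem, Lemma 3.4 "⇒" and `Θ₇ = bP₈`.** The cone target
`Literature.Topology.FourManifolds.exists_commGroup_homotopySphereClass_isCyclic_seven` GIVEN:
(`hrep`) the embedding half of Kervaire–Milnor's Lemma 7.1 at `n = 7`, `m = 2` — a `3`-connected
s-parallelizable oriented null-cobordism `M` of a homotopy `7`-sphere whose closed-model form on
`H⁴(M̂; ℤ)/T` has a Kervaire–Milnor basis contains a finite framed family of disjoint embedded
`4`-spheres with `H₄(M) → H₄(M | ⋃ Sᵢ)` onto and kernel spanned by the sphere classes;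
(`hconn`) the named fact `HomotopySphere.exists_highlyConnected_of_mem_signatureSet`; (`hcob`)
the named fact `nonempty_diffeomorph_of_isHCobordant_of_five_le`; (`hne`) Lemma 3.4 "⇒"
(`HomotopySphere.nonempty_signatureSet_of_boundsParallelizable`); (`hB`) `Θ₇ = bP₈`
(`HomotopySphere.boundsParallelizable_seven`). The surgery (Lemma 7.1 second half with Thm. 6.6)
is proved: `HomotopySphere.lemma71_of_sphereFamily`. Assembly:
`exists_commGroup_homotopySphereClass_isCyclic_seven_of_lemma71`.
[cite: KervaireMilnorAnnals1963, Cor. 7.6 (p. 530, first sentence) at m = 2, with Thm. 7.5, Lemma 7.1 (pp. 526–528), Lemma 7.3 (p. 529), Thm. 6.6 (p. 526), §4 table p. 512] [cite: Kosinski1993, Ch. X, Thm. (2.2), Thm. (3.4)] -/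
theorem exists_commGroup_homotopySphereClass_isCyclic_seven_of_sphereFamily
    (hrep : ∀ (S : HomotopySphere 7) (c : NullCobordism 7 S.carrier)
      (μ : HomologicalOrientation ℤ S.carrier 7)
      (μ' : HomologicalOrientation ℤ (ClosedModel 7 c.W) (7 + 1)),
      SimplyConnectedSpace c.W →
      (∀ i : ℕ, 0 < i → i < 2 * 2 → Subsingleton (singularHomology ℤ ℤ c.W i)) →
      IsStablyParallelizable (𝓡∂ (7 + 1)) c.W → c.IsOrientedBy μ μ' →
      (∃ (r : ℕ) (b : Module.Basis (Fin r ⊕ Fin r) ℤ (freeCohomology ℤ (ClosedModel 7 c.W) (2 * 2))),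
        Module.finrank ℤ (freeCohomology ℤ (ClosedModel 7 c.W) (2 * 2)) = 2 * r ∧
        (∀ i j, intersectionForm (show 2 * 2 + 2 * 2 = 7 + 1 by norm_num) μ'
          (b (Sum.inl i)) (b (Sum.inl j)) = 0) ∧
        ∀ i j, intersectionForm (show 2 * 2 + 2 * 2 = 7 + 1 by norm_num) μ'
          (b (Sum.inl i)) (b (Sum.inr j)) = if i = j then 1 else 0) →
        ∃ (ι : Type) (_ : Fintype ι) (ν : FramedSphereFamily (𝓡∂ (7 + 1)) c.W ι (2 * 2) (2 * 2)),
          Function.Surjective (singularHomology.toLocalOfSet ℤ ℤ c.W ν.cores (2 * 2)) ∧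
          ∀ x : singularHomology ℤ ℤ c.W (2 * 2),
            singularHomology.toLocalOfSet ℤ ℤ c.W ν.cores (2 * 2) x = 0 →
              x ∈ Submodule.span ℤ (⋃ i, Set.range
                (singularHomology.map ℤ ℤ ⟨ν.sphere i, ν.continuous_sphere i⟩ (2 * 2))))
    (hconn : HomotopySphere.exists_highlyConnected_of_mem_signatureSet)
    (hcob : FourManifolds.nonempty_diffeomorph_of_isHCobordant_of_five_le.{0})
    (hne : HomotopySphere.nonempty_signatureSet_of_boundsParallelizable)
    (hB : HomotopySphere.boundsParallelizable_seven) :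
    exists_commGroup_homotopySphereClass_isCyclic_seven :=
  exists_commGroup_homotopySphereClass_isCyclic_seven_of_lemma71
    (HomotopySphere.lemma71_of_sphereFamily (n := 7) (m := 2) (by norm_num) (by norm_num) hrep)
    hconn hcob hne hB

end Literature.Topology.FourManifolds

end
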